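import Summits.Ventures.PercRepro.ThetaOmegaCoreAssembly

/-!
# A typed bad edge excludes every exceptional two-edge point

Dossier proofs/MINE1-theoremS.md, Addendum 81 suppl. 1 (mine-1, gen 42). Let `(s, s + q)` be a
bad edge of type T10 or T01 (`c0 s = c0 (s + q)` or `c1 s = c1 (s + q)`), with mono colour `λ`,
and let `r ≠ q` be a point with two edges `(a, a + r)`, `(b, b + r)` whose edge family is
exceptional: `b` is K-mono (`c0 (b + r) = c1 b =: δ`) and `a` has `c1 a = ¬δ` and is K-mono or
`∅` (`OmegaExcPair`, `ThetaOmegaSmall.lean`). Then the colour rule of the bad edge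
(`badEdge_c0_ne_monoColour`, `badEdge_c1_ne_monoColour`) decides:

* an edge of `r` in general position (no endpoint in `{s, s + q}`) of K-colour `δ'` forces
  `δ' ≠ λ` (`nonTouching_colour_ne`), so both edges in general position is impossible;
* an edge of `r` touching `{s, s + q}` with K-colour `λ` is impossible (`touching_false`): the
  four positions `s = x`, `s = x + r`, `s + q = x`, `s + q = x + r` each give the singleton edge
  `(∅, {q})` or violate the rule;
* both edges touching forces a second edge at `q` (`badEdge_unique`).

**`badEdge_typed_no_excTwo`**: the statement `NoMixed` holds for typed bad edges (and for every
exceptional two-edge point, whatever its credit). The T00 case remains open.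
-/

namespace PercRepro.MSTight

open Finset

variable {α : Type*} [DecidableEq α]

section Unique

variable {q : α} {U : Finset α} {F : Finset (Finset α)} {c0 c1 : Finset α → Bool}
  {s t : Finset α}

/-- Two edges at a point give credit: the edge family has a nonempty `A`-family. -/
theorem one_le_omegaCredit_of_two_edges (hq : q ∈ U) (hs : s ∈ F) (hqs : q ∉ s)
    (hsq : insert q s ∈ F) (ht : t ∈ F) (hqt : q ∉ t) (htq : insert q t ∈ F) (hst : s ≠ t) :
    1 ≤ omegaCredit U F c0 c1 q := by
  have hsK : s ∈ qEdges q F := mem_qEdges.2 ⟨hs, hqs, hsq⟩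
  have htK : t ∈ qEdges q F := mem_qEdges.2 ⟨ht, hqt, htq⟩
  have hA : (omegaA (qEdges q F) (edgeC0 q c0) c1).Nonempty := by
    by_cases h : edgeC0 q c0 s = edgeC0 q c0 t
    · exact ⟨s ⊓ t, inf_mem_omegaA hst hsK htK h⟩
    · by_cases h2 : edgeC0 q c0 s = c1 t
      · exact ⟨s \ t, sdiff_mem_omegaA hsK htK h2⟩
      · have h3 : edgeC0 q c0 t = c1 t := bool_eq_of_ne_of_ne (Ne.symm h) (Ne.symm h2)
        exact ⟨t \ t, sdiff_mem_omegaA htK htK h3⟩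
  have h1 : 1 ≤ omegaCount (U.erase q) (qEdges q F) (edgeC0 q c0) c1 := by
    unfold omegaCount
    have := card_pos.2 hA
    omega
  exact le_trans h1 (omegaCount_qEdges_le_omegaCredit hq)

/-- **A bad edge is the only edge at its point.** -/
theorem badEdge_unique (h : BadEdge U F c0 c1 q s) (ht : t ∈ F) (hqt : q ∉ t)
    (htq : insert q t ∈ F) : t = s := by
  by_contra hne
  have := one_le_omegaCredit_of_two_edges (c0 := c0) (c1 := c1) h.1 h.2.1 h.2.2.1 h.2.2.2.1 ht hqt
    htq (Ne.symm hne)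
  have h0 := h.2.2.2.2.2
  omega

end Unique

section Touch

variable {q r : α} {U : Finset α} {F : Finset (Finset α)} {c0 c1 : Finset α → Bool}
  {s x : Finset α}

/-- Boolean core of the position `s = x`: `c1 s = λ`, `c0 (s + q) ≠ c1 s`, mono colour `λ` force
`s` mono. -/
theorem bool_touchA (a b c l : Bool) (h1 : b = l) (h2 : c ≠ b)
    (hmc : (if a = c then a else b) = l) : a = b := by
  revert a b c l; decide

/-- Boolean core of the position `s + q = x + r`: `c0 (s + q) = λ`, `c1 s ≠ c0 (s + q)`, typed,
mono colour `λ` force `s + q` mono and `c1 s = ¬λ`. -/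
theorem bool_touchD (a b c d l : Bool) (h1 : c = l) (h2 : b ≠ c) (ht : EdgeTyped a b c d)
    (hmc : (if a = c then a else b) = l) : d = c ∧ b = !l := by
  unfold EdgeTyped at ht
  revert a b c d l; decide

/-- `!d ≠ l` gives `d = l`. -/
theorem bool_not_ne (d l : Bool) (h : (!d) ≠ l) : d = l := by revert d l; decide

/-- `d ≠ l` gives `d = !l`. -/
theorem bool_ne_not (d l : Bool) (h : d ≠ l) : d = !l := by revert d l; decide

/-- **An edge of `r` touching the bad edge with K-colour `λ` is impossible.** -/
theorem touching_false (hq : BadEdge U F c0 c1 q s)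
    (hty : c0 s = c0 (insert q s) ∨ c1 s = c1 (insert q s)) (hqr : q ≠ r)
    (hx : x ∈ F) (hrx : r ∉ x) (hvx : insert r x ∈ F) (hcol : c1 x = monoColour c0 c1 q s)
    (hK : c0 (insert r x) = c1 x ∨ x = ∅)
    (htouch : x = s ∨ insert r x = s ∨ x = insert q s ∨ insert r x = insert q s) : False := by
  have hsF := hq.2.1
  have hqs := hq.2.2.1
  have huF := hq.2.2.2.1
  have hexc := hq.2.2.2.2.1
  rcases htouch with h | h | h | h
  · -- `x = s`: the singleton edge `(∅, {q})` from `(s + q) \ (s + r) = {q}`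
    subst h
    have hvs : insert r x ≠ x := fun h => hrx (h ▸ mem_insert_self r x)
    have hvu : insert r x ≠ insert q x := by
      intro h
      have : r ∈ insert q x := h ▸ mem_insert_self r x
      rcases mem_insert.1 this with h' | h'
      · exact hqr h'.symm
      · exact hrx h'
    have hqv : q ∉ insert r x := by
      simp only [mem_insert, not_or]; exact ⟨hqr, hqs⟩
    have h1 := badEdge_c1_ne_monoColour hq hty hvx hvs hvu hqv
    have hc0u : c0 (insert q x) = !monoColour c0 c1 q x := by
      rw [← hcol]; exact bool_ne_not _ _ hexc
    have hc1v : c1 (insert r x) = !monoColour c0 c1 q x := bool_ne_not _ _ h1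
    have hmono : c0 x = c1 x := by
      have := bool_touchA (c0 x) (c1 x) (c0 (insert q x)) (monoColour c0 c1 q x) hcol hexc
        (by unfold monoColour at hcol ⊢; exact rfl)
      exact this
    have := one_le_omegaCredit_of_sdiff_eq_singleton (U := U) hsF hmono huF hvx
      (hc0u.trans hc1v.symm) (insert_sdiff_insert_eq_singleton hqr hqs)
    have h0 := hq.2.2.2.2.2
    omega
  · -- `x + r = s`: `x` avoids `q` and is not `s`, so `c1 x ≠ λ`
    have hrs : r ∈ s := h ▸ mem_insert_self r x
    have hxs : x ≠ s := fun h' => hrx (by rw [h']; exact hrs)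
    have hxu : x ≠ insert q s := fun h' => hrx (by rw [h']; exact mem_insert_of_mem hrs)
    have hqx : q ∉ x := fun h' => hqs (h ▸ mem_insert_of_mem h')
    exact badEdge_c1_ne_monoColour hq hty hx hxs hxu hqx hcol
  · -- `x = s + q`: `x + r` contains `q` and is not `s`, `s + q`, so `c0 (x + r) ≠ λ`
    have hqx : q ∈ x := h ▸ mem_insert_self q s
    have hxne : x ≠ ∅ := fun h' => by rw [h'] at hqx; exact notMem_empty q hqx
    have hK' : c0 (insert r x) = c1 x := hK.resolve_right hxne
    have hvs : insert r x ≠ s := fun h' => hqs (h' ▸ mem_insert_of_mem hqx)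
    have hvu : insert r x ≠ insert q s := by
      intro h'
      rw [← h] at h'
      exact hrx (h' ▸ mem_insert_self r x)
    have hqv : q ∈ insert r x := mem_insert_of_mem hqx
    have := badEdge_c0_ne_monoColour hq hty hvx hvs hvu hqv
    exact this (hK'.trans hcol)
  · -- `x + r = s + q`: `x ∖ s = {q}` and `s + q` mono give the singleton edge
    have hqx : q ∈ x := by
      have : q ∈ insert r x := h ▸ mem_insert_self q s
      rcases mem_insert.1 this with h' | h'
      · exact absurd h' hqr
      · exact h'
    have hxne : x ≠ ∅ := fun h' => by rw [h'] at hqx; exact notMem_empty q hqx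
    have hK' : c0 (insert r x) = c1 x := hK.resolve_right hxne
    have hru : r ∈ insert q s := h ▸ mem_insert_self r x
    have hrs : r ∈ s := by
      rcases mem_insert.1 hru with h' | h'
      · exact absurd h'.symm hqr
      · exact h'
    have hxs : x ≠ s := fun h' => hqs (h' ▸ hqx)
    have hxu : x ≠ insert q s := fun h' => hrx (h' ▸ hru)
    have h1 := badEdge_c0_ne_monoColour hq hty hx hxs hxu hqx
    have hc0u : c0 (insert q s) = monoColour c0 c1 q s := by rw [← h, hK', hcol]
    have hty' := badEdge_typed hq hx hxs hxu
    have hd := bool_touchD (c0 s) (c1 s) (c0 (insert q s)) (c1 (insert q s)) (monoColour c0 c1 q s)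
      hc0u (Ne.symm hexc) hty' (by unfold monoColour at hc0u ⊢; exact rfl)
    have hxq : x = (insert q s).erase r := by rw [← h, erase_insert hrx]
    have hsq : s = (insert q s).erase q := (erase_insert hqs).symm
    have hsing : x \ s = {q} := by
      rw [hxq]
      conv_rhs => rw [← erase_sdiff_erase_eq_singleton (u := insert q s) hqr (mem_insert_self q s)]
      rw [← hsq]
    have hcx : c0 x = c1 s := by
      rw [bool_ne_not _ _ h1, hd.2]
    have := one_le_omegaCredit_of_sdiff_eq_singleton (U := U) huF hd.1.symm hx hsF hcx hsing
    have h0 := hq.2.2.2.2.2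
    omega

end Touch

section Main

variable {q r : α} {U : Finset α} {F : Finset (Finset α)} {c0 c1 : Finset α → Bool}
  {s x : Finset α}

/-- **An edge of `r` in general position has K-colour different from the mono colour** (when it is
K-mono or `∅`, measured by `c1 x`). -/
theorem nonTouching_colour_ne (hq : BadEdge U F c0 c1 q s)
    (hty : c0 s = c0 (insert q s) ∨ c1 s = c1 (insert q s))
    (hx : x ∈ F) (hvx : insert r x ∈ F) (hK : c0 (insert r x) = c1 x ∨ x = ∅)
    (hxs : x ≠ s) (hxu : x ≠ insert q s) (hvs : insert r x ≠ s) (hvu : insert r x ≠ insert q s) :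
    c1 x ≠ monoColour c0 c1 q s := by
  by_cases hqx : q ∈ x
  · have hxne : x ≠ ∅ := fun h' => by rw [h'] at hqx; exact notMem_empty q hqx
    have hK' : c0 (insert r x) = c1 x := hK.resolve_right hxne
    have := badEdge_c0_ne_monoColour hq hty hvx hvs hvu (mem_insert_of_mem hqx)
    rwa [hK'] at this
  · exact badEdge_c1_ne_monoColour hq hty hx hxs hxu hqx

/-- Whether an edge `(x, x + r)` touches `{s, s + q}`. -/
theorem touch_or_not (x s : Finset α) (q r : α) :
    (x = s ∨ insert r x = s ∨ x = insert q s ∨ insert r x = insert q s) ∨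
      (x ≠ s ∧ x ≠ insert q s ∧ insert r x ≠ s ∧ insert r x ≠ insert q s) := by
  by_cases h1 : x = s
  · exact Or.inl (Or.inl h1)
  by_cases h2 : insert r x = s
  · exact Or.inl (Or.inr (Or.inl h2))
  by_cases h3 : x = insert q s
  · exact Or.inl (Or.inr (Or.inr (Or.inl h3)))
  by_cases h4 : insert r x = insert q s
  · exact Or.inl (Or.inr (Or.inr (Or.inr h4)))
  exact Or.inr ⟨h1, h3, h2, h4⟩

/-- **Both edges of `r` touching the bad edge is impossible** (a second edge at `q` appears). -/
theorem both_touching_false (hq : BadEdge U F c0 c1 q s) (hqr : q ≠ r) {a b : Finset α}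
    (hab : a ≠ b) (ha : a ∈ F) (hra : r ∉ a) (hva : insert r a ∈ F)
    (hb : b ∈ F) (hrb : r ∉ b) (hvb : insert r b ∈ F)
    (ta : a = s ∨ insert r a = s ∨ a = insert q s ∨ insert r a = insert q s)
    (tb : b = s ∨ insert r b = s ∨ b = insert q s ∨ insert r b = insert q s) : False := by
  have hqs := hq.2.2.1
  have hrs_of_u : r ∈ insert q s → r ∈ s := by
    intro h
    rcases mem_insert.1 h with h' | h'
    · exact absurd h'.symm hqr
    · exact h'
  rcases tb with hb1 | hb2 | hb3 | hb4 <;> rcases ta with ha1 | ha2 | ha3 | ha4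
  · exact hab (ha1.trans hb1.symm)
  · -- `a + r = s = b`: `r ∈ s` but `r ∉ b`
    exact hrb (hb1 ▸ (ha2 ▸ mem_insert_self r a))
  · -- `b = s`, `a = s + q`: `(b + r, a + r)` is a second edge at `q`
    have hqvb : q ∉ insert r b := by
      rw [hb1]; simp only [mem_insert, not_or]; exact ⟨hqr, hqs⟩
    have hins : insert q (insert r b) = insert r a := by
      rw [ha3, hb1, insert_comm]
    have := badEdge_unique hq hvb hqvb (hins ▸ hva)
    exact hrb (hb1 ▸ (this ▸ mem_insert_self r b))
  · -- `b = s`, `a + r = s + q`: `r ∈ s` but `r ∉ b = s`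
    exact hrb (hb1 ▸ hrs_of_u (ha4 ▸ mem_insert_self r a))
  · -- `b + r = s = a`: `r ∈ s` but `r ∉ a`
    exact hra (ha1 ▸ (hb2 ▸ mem_insert_self r b))
  · exact hab (insert_injective_of_notMem hra hrb (ha2.trans hb2.symm))
  · -- `b + r = s`, `a = s + q`: `r ∈ s ⊆ a` but `r ∉ a`
    exact hra (ha3 ▸ mem_insert_of_mem (hb2 ▸ mem_insert_self r b))
  · -- `b + r = s`, `a + r = s + q`: `(b, a)` is a second edge at `q`
    have hins : insert q b = a := by
      have h1 : (insert r a).erase r = a := erase_insert hra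
      have h2 : (insert r b).erase r = b := erase_insert hrb
      rw [← h1, ha4, ← h2, hb2, erase_insert_of_ne hqr]
    have hqb : q ∉ b := fun h => hqs (hb2 ▸ mem_insert_of_mem h)
    have := badEdge_unique hq hb hqb (hins ▸ ha)
    exact hrb (this ▸ hrs_of_u (ha4 ▸ mem_insert_self r a))
  · -- `b = s + q`, `a = s`: `(a + r, b + r)` is a second edge at `q`
    have hqva : q ∉ insert r a := by
      rw [ha1]; simp only [mem_insert, not_or]; exact ⟨hqr, hqs⟩
    have hins : insert q (insert r a) = insert r b := by
      rw [hb3, ha1, insert_comm]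
    have := badEdge_unique hq hva hqva (hins ▸ hvb)
    exact hra (ha1 ▸ (this ▸ mem_insert_self r a))
  · -- `b = s + q`, `a + r = s`: `r ∈ s ⊆ b` but `r ∉ b`
    exact hrb (hb3 ▸ mem_insert_of_mem (ha2 ▸ mem_insert_self r a))
  · exact hab (ha3.trans hb3.symm)
  · -- `b = s + q = a + r`: `r ∈ b`
    exact hrb (hb3 ▸ (ha4 ▸ mem_insert_self r a))
  · -- `b + r = s + q`, `a = s`: `r ∈ s` but `r ∉ a = s`
    exact hra (ha1 ▸ hrs_of_u (hb4 ▸ mem_insert_self r b))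
  · -- `b + r = s + q`, `a + r = s`: `(a, b)` is a second edge at `q`
    have hins : insert q a = b := by
      have h1 : (insert r a).erase r = a := erase_insert hra
      have h2 : (insert r b).erase r = b := erase_insert hrb
      rw [← h2, hb4, ← h1, ha2, erase_insert_of_ne hqr]
    have hqa : q ∉ a := fun h => hqs (ha2 ▸ mem_insert_of_mem h)
    have := badEdge_unique hq ha hqa (hins ▸ hb)
    exact hra (this ▸ hrs_of_u (hb4 ▸ mem_insert_self r b))
  · -- `b + r = s + q = a`: `r ∈ a`
    exact hra (ha3 ▸ (hb4 ▸ mem_insert_self r b))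
  · exact hab (insert_injective_of_notMem hra hrb (ha4.trans hb4.symm))

/-- **A typed bad edge excludes every exceptional two-edge point**: `b` K-mono of colour `δ`,
`a` with `c1 a = ¬δ` and K-mono or `∅`. -/
theorem badEdge_typed_no_excTwo_core (hq : BadEdge U F c0 c1 q s)
    (hty : c0 s = c0 (insert q s) ∨ c1 s = c1 (insert q s)) (hqr : q ≠ r) {a b : Finset α}
    (hab : a ≠ b) (ha : a ∈ F) (hra : r ∉ a) (hva : insert r a ∈ F)
    (hb : b ∈ F) (hrb : r ∉ b) (hvb : insert r b ∈ F)
    (hKb : c0 (insert r b) = c1 b) (hKa : c0 (insert r a) = c1 a ∨ a = ∅)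
    (hopp : c1 a ≠ c1 b) : False := by
  rcases touch_or_not b s q r with tb | ⟨hbs, hbu, hvbs, hvbu⟩ <;>
    rcases touch_or_not a s q r with ta | ⟨has, hau, hvas, hvau⟩
  · exact both_touching_false hq hqr hab ha hra hva hb hrb hvb ta tb
  · -- `b` touches, `a` in general position: `c1 a = ¬δ ≠ λ` gives `δ = λ`
    have hne := nonTouching_colour_ne hq hty ha hva hKa has hau hvas hvau
    have hcol : c1 b = monoColour c0 c1 q s := by
      have : c1 a = !c1 b := bool_ne_not _ _ hopp
      rw [this] at hne
      exact bool_not_ne _ _ hne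
    exact touching_false hq hty hqr hb hrb hvb hcol (Or.inl hKb) tb
  · -- `a` touches, `b` in general position: `δ ≠ λ` gives `c1 a = λ`
    have hne := nonTouching_colour_ne hq hty hb hvb (Or.inl hKb) hbs hbu hvbs hvbu
    have hcol : c1 a = monoColour c0 c1 q s := by
      rw [bool_ne_not _ _ hopp, bool_ne_not _ _ hne, Bool.not_not]
    exact touching_false hq hty hqr ha hra hva hcol hKa ta
  · have h1 := nonTouching_colour_ne hq hty hb hvb (Or.inl hKb) hbs hbu hvbs hvbu
    have h2 := nonTouching_colour_ne hq hty ha hva hKa has hau hvas hvau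
    rw [bool_ne_not _ _ hopp] at h2
    exact h1 (bool_not_ne _ _ h2)

/-- **NoMixed for typed bad edges**: a bad edge of type T10 or T01 and a point `r ≠ q` with an
exceptional two-edge family cannot coexist. -/
theorem badEdge_typed_no_excTwo (hq : BadEdge U F c0 c1 q s)
    (hty : c0 s = c0 (insert q s) ∨ c1 s = c1 (insert q s)) (hqr : q ≠ r)
    (h2 : (qEdges r F).card = 2)
    (hexc : omegaCount (U.erase r) (qEdges r F) (edgeC0 r c0) c1 < 2) : False := by
  obtain ⟨w, w', hww', hK⟩ := card_eq_two.1 h2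
  have hwK : w ∈ qEdges r F := by rw [hK]; exact mem_insert_self w {w'}
  have hw'K : w' ∈ qEdges r F := by rw [hK]; exact mem_insert_of_mem (mem_singleton_self w')
  obtain ⟨hw, hrw, hvw⟩ := mem_qEdges.1 hwK
  obtain ⟨hw', hrw', hvw'⟩ := mem_qEdges.1 hw'K
  -- the edge family is an exceptional pair
  have hpair : OmegaExcPair (edgeC0 r c0) c1 w w' := by
    by_contra hnot
    have := two_le_omegaCount_of_pair (U := U.erase r) hwK hw'K hww'
      (fun h => hnot (Or.inl h)) (fun h => hnot (Or.inr (Or.inl h)))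
      (fun h => hnot (Or.inr (Or.inr h)))
    omega
  rcases hpair with ⟨hmw, hmw', hne⟩ | ⟨hw0, hmw', hne⟩ | ⟨hw'0, hmw, hne⟩
  · -- both K-mono of different colours
    have hopp : c1 w ≠ c1 w' := by
      intro h
      exact hne ((hmw.trans h).trans hmw'.symm)
    exact badEdge_typed_no_excTwo_core hq hty hqr hww' hw hrw hvw hw' hrw' hvw' hmw'
      (Or.inl hmw) hopp
  · -- `w = ∅`, `w'` K-mono, `c1 ∅ ≠ c1 w'`
    have hopp : c1 w ≠ c1 w' := fun h => hne (h.trans hmw'.symm)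
    exact badEdge_typed_no_excTwo_core hq hty hqr hww' hw hrw hvw hw' hrw' hvw' hmw'
      (Or.inr hw0) hopp
  · -- `w' = ∅`, `w` K-mono, `c1 ∅ ≠ c1 w`
    have hopp : c1 w' ≠ c1 w := fun h => hne (h.trans hmw.symm)
    exact badEdge_typed_no_excTwo_core hq hty hqr (Ne.symm hww') hw' hrw' hvw' hw hrw hvw hmw
      (Or.inr hw'0) hopp

end Main

end PercRepro.MSTight
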